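import Summits.BirchSwinnertonDyer.Rank1Residual.X11b.AnticyclotomicCoinvariants
import HarnessLib

/-!
# Crux `AnticycControlAdditive` (route `SchneiderFreeAdditiveX3`, items stmt-BirchSwinnertonDyer-19178 /
# 19295): (P9⁺) on the `t_p ≥ 1` half — lifting local classes at `Σ` AND at `𝔭` WITHOUT (iv)

Seat `bsd-schneider-door-c4`, gen 2 (cell `bsd-schneider-ideate`). The X11b cell's
`AcSelmer.levelLiftingP_of_finite` (route R1, the global-surgery input of atom (L10) and the element form
of (P9) with the `𝔭`-component) assumes Castella's (iv) `E[p^∞]^{Γ_{K_𝔭}} = 0`, used at ONE point: to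
make the propagated strict condition `𝓛^{(N)}_𝔭 ⊆ H¹(K_𝔭, E[p^N])` vanish, so that the Poitou–Tate lift
hits the prescribed class at `𝔭` on the nose at level `N`. On the `t_p ≥ 1` half of the crux (iv) FAILS,
but the conclusion survives: `𝓛^{(N)}_𝔭` is by construction the KERNEL of
`H¹(ι_N) : H¹(K_𝔭, E[p^N]) → H¹(K_𝔭, E[p^∞])` (`acLevelStructure_eq_ker_of` ∘ `acStructure_self`), so the
lift still hits `τ_𝔭` after `H¹(ι_N)` — which is all the statement asserts.

* **`levelLiftingP_of_finite_noLocal`** — `AcSelmer.levelLiftingP_of_finite` VERBATIM (credit: sub-cell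
  multr1-p1) minus the hypothesis `hΓ𝔭`, with the last step at `𝔭` replaced by the kernel argument.
  Hypotheses: the cited Poitou–Tate fact `poitouTate_selmerStructure_duality K`; all infinite places
  complex; `E[p^∞]^{Γ_K} = 0` (i.e. `E(K)[p] = 0`, regime B1); `𝔭, 𝔮 ∣ p`, `𝔮 ≠ 𝔭`; `Σ` away from `p`;
  `T ⊇ ∞ ∪ {v∣p} ∪ Σ ∪ {bad}`; `Finite (H¹_{𝓛^{ac,R}_𝔮}(K, E[p^∞]))`.

CONDITIONAL on the cited fact (hypothesis); no `Prop` fact minted; closes nothing by itself; BSD is not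
proved by any of this.

References: [JetchevSkinnerWan2017] Prop. 3.3.2, Lemma 3.3.3 (arXiv:1512.06894 pp. 11–12);
[Howard2004HeegnerKolyvagin] Thm. 2.1.11; [Castella2018] Def. 2.2, Thm. 2.3 (arXiv:1704.06608 p. 5).
-/

noncomputable section

open scoped Classical

open CategoryTheory Field NumberField IsDedekindDomain
open Literature.NumberTheory.EllipticCurves Literature.NumberTheory.EllipticCurves.GreenbergSelmer
open Literature.NumberTheory.GaloisRepresentations
open Literature.NumberTheory.GaloisRepresentations.DiscreteGaloisModule (SelmerStructure TateDual
  tateDual localTatePairingZMod unramifiedSubgroup)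
open Literature.NumberTheory.GaloisCohomology
open scoped ContRepresentation

set_option linter.dupNamespace false

namespace Summit.BirchSwinnertonDyer.BirchSwinnertonDyer.Theorems.SchneiderFreeAdditiveX3

open Summit.BirchSwinnertonDyer.Rank1Residual.X11b
open Summit.BirchSwinnertonDyer.Rank1Residual.X11b.AcSelmer
open Summit.BirchSwinnertonDyer.Rank1Residual.X11b.LocBridge
open Summit.BirchSwinnertonDyer.Rank1Residual.X11b.Levels
open Summit.BirchSwinnertonDyer.Rank1Residual.X11b.Coinv
open Summit.BirchSwinnertonDyer.Rank1Residual.X11b.ProcyclicDescent (kerK)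
open Summit.BirchSwinnertonDyer.Rank1Residual.X11b.H2Support
open Function


section LiftP

variable {K : Type} [Field K] [NumberField K] (W : WeierstrassCurve K) [W.IsElliptic] (p : ℕ)
  [Fact p.Prime] (𝔭 : HeightOneSpectrum (𝓞 K)) (S : Set (HeightOneSpectrum (𝓞 K)))

/-- **(P9⁺) WITHOUT (iv): lifting with prescribed localisations on `Σ` AND at `𝔭`.** Hypotheses as in
`AcSelmer.levelLiftingP_of_finite` except that `E[p^∞]^{Γ_{K_𝔭}} = 0` is NOT assumed. For every `K₀` and
every family `τ_v ∈ H¹(K_v, E[p^∞])`, `v ∈ Σ⁺ = Σ ∪ {𝔭}`, killed by `p^{K₀}`, there are `N` and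
`x ∈ H¹_{𝓖⁺}(K, E[p^N])` with `loc_v (H¹(ι_N) x) = τ_v` for all `v ∈ Σ⁺`. At `𝔭` the lower structure is
the kernel of `H¹(ι_N)` at `K_𝔭`, which is all that is needed.
[cite: JetchevSkinnerWan2017, Prop. 3.3.2 and Lemma 3.3.3 (arXiv:1512.06894 pp. 11–12)]
[cite: Howard2004HeegnerKolyvagin, Thm. 2.1.11 (arXiv:1202.6340 p. 6)] -/
theorem levelLiftingP_of_finite_noLocal (T : Finset (Place K)) (hPT : poitouTate_selmerStructure_duality K)
    (hK : ∀ w : InfinitePlace K, w.IsComplex)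
    (hΓ : ∀ Q : W.geomPrimaryTorsion p,
      (∀ σ : absoluteGaloisGroup K, primaryGaloisModule W p σ Q = Q) → Q = 0)
    {𝔮 : HeightOneSpectrum (𝓞 K)} (h𝔭 : ((p : ℕ) : 𝓞 K) ∈ 𝔭.asIdeal)
    (h𝔮 : ((p : ℕ) : 𝓞 K) ∈ 𝔮.asIdeal) (hne : 𝔮 ≠ 𝔭)
    (hSp : ∀ v ∈ S, ((p : ℕ) : 𝓞 K) ∉ v.asIdeal)
    (hinf : ∀ w : InfinitePlace K, (Sum.inl w : Place K) ∈ T)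
    (hp : ∀ v : HeightOneSpectrum (𝓞 K), ((p : ℕ) : 𝓞 K) ∈ v.asIdeal → (Sum.inr v : Place K) ∈ T)
    (hSig : ∀ v ∈ S, (Sum.inr v : Place K) ∈ T)
    (hbad : ∀ v : HeightOneSpectrum (𝓞 K), ¬ W.HasGoodReductionAt v → (Sum.inr v : Place K) ∈ T)
    (hfin : Finite ((acStructure (primaryGaloisModule W p) p 𝔮
      {v | (Sum.inr v : Place K) ∈ T ∧ ((p : ℕ) : 𝓞 K) ∉ v.asIdeal}).selmerGroup))
    (K₀ : ℕ) (τ : ∀ v : (insert 𝔭 S : Set (HeightOneSpectrum (𝓞 K))),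
      galoisCohomology
        ((primaryGaloisModule W p).toLocal (Sum.inr (v : HeightOneSpectrum (𝓞 K)))) 1)
    (hτ : ∀ v, p ^ K₀ • τ v = 0) :
    ∃ (N : ℕ) (x : galoisCohomology (W.torsionGaloisModule ((p ^ N : ℕ) : ℤ)) 1),
      x ∈ (upperStructureP W p N 𝔭 S).selmerGroup ∧
        ∀ v : (insert 𝔭 S : Set (HeightOneSpectrum (𝓞 K))),
          galoisCohomology.localization (primaryGaloisModule W p)
            (Sum.inr (v : HeightOneSpectrum (𝓞 K))) 1
            (galoisCohomology.map (primaryInclusion W p N) 1 x) = τ v := by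
  have hdiv : W.zsmul_geomPoints_surjective := W.zsmul_geomPoints_surjective_holds
  have hSig' : ∀ v ∈ insert 𝔭 S, (Sum.inr v : Place K) ∈ T := by
    intro v hv
    rcases Set.mem_insert_iff.1 hv with rfl | hv
    · exact hp v h𝔭
    · exact hSig v hv
  -- the exponent `e ≥ 1` of the relaxed conjugate group and the level `N = K₀ + e`
  haveI := hfin
  obtain ⟨e, he1, he⟩ := exists_pow_nsmul_eq_zero_of_finite
    ((acStructure (primaryGaloisModule W p) p 𝔮
      {v | (Sum.inr v : Place K) ∈ T ∧ ((p : ℕ) : 𝓞 K) ∉ v.asIdeal}).selmerGroup)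
  -- instances at level `p^N` (cup products need `CompactSpace Γ`; `E[p^N]` finite; `p^N ≠ 0`)
  haveI : CompactSpace (absoluteGaloisGroup K) := absoluteGaloisGroup_compactSpace K
  haveI : NeZero (p ^ (K₀ + e)) := ⟨pow_ne_zero _ (Fact.out : p.Prime).ne_zero⟩
  haveI : NeZero (p ^ K₀) := ⟨pow_ne_zero _ (Fact.out : p.Prime).ne_zero⟩
  haveI : Finite (W.geomTorsion ((p ^ (K₀ + e) : ℕ) : ℤ)) :=
    W.finite_torsionPoints_holds (AlgebraicClosure K)
      (by exact_mod_cast pow_ne_zero (K₀ + e) (Fact.out : p.Prime).ne_zero)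
  -- the Poitou–Tate family at level `p^N`
  obtain ⟨inv, hperf, -, hur, hcompl⟩ := hPT (p ^ (K₀ + e))
  -- local lifts `s_v ∈ H¹(K_v, E[p^{K₀}])` of the `τ_v`
  have hs : ∀ v : (insert 𝔭 S : Set (HeightOneSpectrum (𝓞 K))),
      ∃ sv : galoisCohomology (GaloisRep.restrictField
      (Place.Completion (Sum.inr (v : HeightOneSpectrum (𝓞 K)) : Place K))
      (W.torsionGaloisModule ((p ^ K₀ : ℕ) : ℤ))) 1,
      galoisCohomology.map ((primaryInclusion W p K₀).restrictField
        (Place.Completion (Sum.inr (v : HeightOneSpectrum (𝓞 K)) : Place K))) 1 sv = τ v := fun v ↦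
    (mem_range_map_primaryInclusion_restrictField_iff W p K₀ _ hdiv (τ v)).mpr (hτ v)
  choose s hs using hs
  -- the Poitou–Tate data
  have hMn : ∀ m : W.geomTorsion ((p ^ (K₀ + e) : ℕ) : ℤ), (p ^ (K₀ + e)) • m = 0 := fun m ↦
    AddSubgroup.torsionBy.nsmul m
  have hTout : ∀ v : HeightOneSpectrum (𝓞 K), (Sum.inr v : Place K) ∉ T →
      ((p ^ (K₀ + e) : ℕ) : 𝓞 K) ∉ v.asIdeal ∧
        GaloisRep.IsUnramifiedAt v (W.torsionGaloisModule ((p ^ (K₀ + e) : ℕ) : ℤ)) := by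
    intro v hv
    have hpv : ((p : ℕ) : 𝓞 K) ∉ v.asIdeal := fun h ↦ hv (hp v h)
    have hgood : W.HasGoodReductionAt v := by
      by_contra hbad'
      exact hv (hbad v hbad')
    exact ⟨natCast_pow_not_mem p hpv _,
      isUnramifiedAt_torsionGaloisModule W hgood (intCast_pow_not_mem p hpv _)⟩
  have ht : ∀ v ∈ T, liftFamily W p K₀ e s v ∈ upperStructureP W p (K₀ + e) 𝔭 S v := by
    intro v _
    rcases v with w | v
    · rw [liftFamily_inl]; exact zero_mem _
    · by_cases hvI : v ∈ insert 𝔭 S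
      · by_cases hv𝔭 : v = 𝔭
        · subst hv𝔭
          rw [upperStructureP_self]; exact AddSubgroup.mem_top _
        · have hvS : v ∈ S := by
            rcases Set.mem_insert_iff.1 hvI with h | h
            · exact (hv𝔭 h).elim
            · exact h
          rw [upperStructureP_of_ne W p (K₀ + e) 𝔭 S (fun h ↦ hv𝔭 (Sum.inr_injective h)),
            acLevelStructure_eq_top_of_mem_S W p (K₀ + e) 𝔭 S hvS hv𝔭]
          exact AddSubgroup.mem_top _
      · rw [liftFamily_inr_of_not_mem W p K₀ e s hvI]; exact zero_mem _
  -- Poitou–Tate: the lift exists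
  obtain ⟨x, hx, hxt⟩ := (hcompl (W.torsionGaloisModule ((p ^ (K₀ + e) : ℕ) : ℤ)) hMn T hTout
    (lowerStructure W p (K₀ + e) 𝔭 (insert 𝔭 S) T) (upperStructureP W p (K₀ + e) 𝔭 S)
    (lowerStructure_insert_le_upperStructureP W p (K₀ + e) 𝔭 S T)
    (lowerStructure_isUnramifiedOutside W p (K₀ + e) 𝔭 (insert 𝔭 S) T hinf hp hSig' hbad)
    (upperStructureP_isUnramifiedOutside W p (K₀ + e) 𝔭 S T h𝔭 hinf hp hSig hbad)).1
    (liftFamily W p K₀ e s) ht fun y hy ↦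
      sum_localTatePairingZMod_liftFamily_eq_zero W p 𝔭 T K₀ e hK hΓ h𝔮 hne hSig' hbad he1 he hperf
        hur s hy
  refine ⟨K₀ + e, x, hx, fun v ↦ ?_⟩
  have hv := hxt (Sum.inr (v : HeightOneSpectrum (𝓞 K))) (hSig' v v.2)
  by_cases hv𝔭 : (v : HeightOneSpectrum (𝓞 K)) = 𝔭
  · -- at `𝔭` the lower structure is Castella's PROPAGATED strict condition, the kernel of
    -- `H¹(K_𝔭, E[p^N]) → H¹(K_𝔭, E[p^∞])`: the lift hits `τ_𝔭` after `H¹(ι_N)` (no (iv) needed)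
    rw [lowerStructure_inr_of_not W p (K₀ + e) 𝔭 (insert 𝔭 S) T
        (fun h ↦ h.2 (by rw [hv𝔭]; exact h𝔭)), hv𝔭, acLevelStructure_insert_self,
      acLevelStructure_eq_ker_of W p (K₀ + e) 𝔭 S (acStructure_self (primaryGaloisModule W p) p 𝔭 S)]
      at hv
    have hv2 := (AddMonoidHom.mem_ker).1 hv
    rw [map_sub, sub_eq_zero] at hv2
    have hv' : galoisCohomology.map ((primaryInclusion W p (K₀ + e)).restrictField
        (Place.Completion (Sum.inr (v : HeightOneSpectrum (𝓞 K)) : Place K))) 1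
        (galoisCohomology.localization (W.torsionGaloisModule ((p ^ (K₀ + e) : ℕ) : ℤ))
          (Sum.inr (v : HeightOneSpectrum (𝓞 K))) 1 x) =
        galoisCohomology.map ((primaryInclusion W p (K₀ + e)).restrictField
        (Place.Completion (Sum.inr (v : HeightOneSpectrum (𝓞 K)) : Place K))) 1
        (liftFamily W p K₀ e s (Sum.inr (v : HeightOneSpectrum (𝓞 K)))) := by
      rw [hv𝔭]
      exact hv2
    rw [localization_map_one, hv', liftFamily_inr_of_mem W p K₀ e s v.2,
      map_primaryInclusion_map_levelIncl_restrictField]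
    exact hs v
  · have hvS : (v : HeightOneSpectrum (𝓞 K)) ∈ S := by
      rcases Set.mem_insert_iff.1 v.2 with h | h
      · exact (hv𝔭 h).elim
      · exact h
    have h0 : lowerStructure W p (K₀ + e) 𝔭 (insert 𝔭 S) T
        (Sum.inr (v : HeightOneSpectrum (𝓞 K))) = ⊥ :=
      lowerStructure_inr_of_mem W p (K₀ + e) 𝔭 (insert 𝔭 S) T (hSig' v v.2) (hSp _ hvS)
    rw [h0, AddSubgroup.mem_bot, sub_eq_zero, liftFamily_inr_of_mem W p K₀ e s v.2] at hv
    rw [localization_map_one, hv, map_primaryInclusion_map_levelIncl_restrictField]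
    exact hs v

end LiftP

section Coinvariants

variable {K : Type} [Field K] [NumberField K] (W : WeierstrassCurve K) [W.IsElliptic] (p : ℕ)
  [Fact p.Prime] (κ : ZpExtension K p)

/-! ## §2. (L10) without (iv): `CoinvariantsTrivialAt` from `H²(K, E[p^∞]) = 0` and `E(K)[p] = 0` -/

/-- **(L10) `CoinvariantsTrivialAt` from `H²(K, E[p^∞]) = 0`, WITHOUT the local hypothesis (iv)** —
`Coinv.coinvariantsTrivialAt_of_subsingleton` (JSW17 Lemma 3.3.3 in route R1's `K_∞`-formulation, credit
sub-cell multr1-p1) VERBATIM with the local no-invariants hypothesis `E[p^∞]^{Γ_{K_𝔭}} = 0` replaced by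
the GLOBAL one `E[p^∞]^{Γ_K} = 0` (`E(K)[p] = 0`, regime B1), the Poitou–Tate surgery step now being
`levelLiftingP_of_finite_noLocal`. Hypotheses: `K` totally complex; the cited Poitou–Tate fact and Milne
I 2.8 at the completions; `𝔭 ≠ 𝔮` above `p`; `Sel_𝔮(K, E[p^∞])` finite; `H²(K, E[p^∞]) = 0`; `γ` a
topological generator of `κ`. Conclusion: `conj_γ − 1` is onto `Sel_𝔭(K_∞, E[p^∞])`.
[cite: JetchevSkinnerWan2017, Lemma 3.3.3 and Prop. 3.3.2 (arXiv:1512.06894 pp. 11–12)]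
[cite: Castella2018, Thm. 2.3 (arXiv:1704.06608 p. 5)] -/
theorem coinvariantsTrivialAt_of_subsingleton_noLocal [IsTotallyComplex K]
    (hPT : poitouTate_selmerStructure_duality K)
    (hEP : ∀ v : HeightOneSpectrum (𝓞 K), localEulerPoincareCharacteristic (v.adicCompletion K))
    {𝔭 𝔮 : HeightOneSpectrum (𝓞 K)} (h𝔭 : ((p : ℕ) : 𝓞 K) ∈ 𝔭.asIdeal)
    (h𝔮 : ((p : ℕ) : 𝓞 K) ∈ 𝔮.asIdeal) (hne : 𝔮 ≠ 𝔭)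
    (hΓ : ∀ Q : W.geomPrimaryTorsion p,
      (∀ σ : absoluteGaloisGroup K, primaryGaloisModule W p σ Q = Q) → Q = 0)
    (hfin : Finite (selmerAcBase W p 𝔮 ∅))
    (h2 : Subsingleton (galoisCohomology (primaryGaloisModule W p) 2))
    {γ : absoluteGaloisGroup K} (hγ : κ.IsTopGenerator γ) :
    CoinvariantsTrivialAt W p κ 𝔭 γ := by
  intro x
  have hM : ∀ m : W.geomPrimaryTorsion p, IsOpen {σ : absoluteGaloisGroup K | σ • m = m} :=
    isOpen_stabilizer_geomPrimaryTorsion W p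
  -- (1) `y₀` with `conj_γ y₀ - y₀ = x`
  obtain ⟨y₀, hy₀⟩ :=
    exists_conjH1_sub_eq_of_subsingleton W p κ h2 hγ (x : W.subgroupH1 p κ.kerSubgroup)
  -- (2) all conjugates of `y₀` agree with `y₀` modulo `Sel`
  have hSel : ∀ g : absoluteGaloisGroup K,
      W.conjH1 p κ.kerSubgroup g y₀ - y₀ ∈ selmerAc W p κ 𝔭 ∅ :=
    conjH1_sub_mem_selmerAc_of_isTopGenerator hγ (by rw [hy₀]; exact x.2)
  -- the cocycle of `y₀` and its zero set
  obtain ⟨φ, hφ⟩ := oneCocycleClass_surjective _ y₀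
  obtain ⟨N₁, hN₁⟩ := exists_openNormalSubgroup_forall_apply_eq_zero (K := K) φ
  -- the exceptional set `Σ'` (finite, away from `p`)
  set S' : Set (HeightOneSpectrum (𝓞 K)) := {v | ((p : ℕ) : 𝓞 K) ∉ v.asIdeal ∧
    (¬ W.HasGoodReductionAt v ∨
      ¬ (adicCompletionPrime K v).inertia (absoluteGaloisGroup K) ≤ (N₁ : Subgroup _))} with hS'
  have hS'fin : S'.Finite := finite_exceptional W p N₁
  have hSp : ∀ v ∈ S', ((p : ℕ) : 𝓞 K) ∉ v.asIdeal := fun v hv ↦ hv.1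
  -- (3) the local lifts
  have hz : ∀ v : HeightOneSpectrum (𝓞 K), (((p : ℕ) : 𝓞 K) ∉ v.asIdeal ∨ v = 𝔭) →
      ∃ z : subgroupH1 (decomp (K := K) v) (W.geomPrimaryTorsion p),
        ResKernel.resSubgroup (kerD κ v) (W.geomPrimaryTorsion p) z =
          resKerD κ (W.geomPrimaryTorsion p) v y₀ := fun v hv ↦
    exists_resSubgroup_kerD_eq v (hv.imp (fun h ↦ ⟨h, Set.notMem_empty v⟩) id) hSel
  choose z hz using hz
  -- at the good unramified `v ∉ Σ'`, `v ∤ p`: `Ψ_v = 0` and `y₀` is locally trivial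
  have hzero : ∀ (v : HeightOneSpectrum (𝓞 K)) (hpv : ((p : ℕ) : 𝓞 K) ∉ v.asIdeal), v ∉ S' →
      resKerD κ (W.geomPrimaryTorsion p) v y₀ = 0 := by
    intro v hpv hvS
    have hgood : W.HasGoodReductionAt v := by
      by_contra h; exact hvS ⟨hpv, Or.inl h⟩
    have hI : (adicCompletionPrime K v).inertia (absoluteGaloisGroup K) ≤ (N₁ : Subgroup _) := by
      by_contra h; exact hvS ⟨hpv, Or.inr h⟩
    have h := hz v (Or.inl hpv)
    rw [← hφ] at h ⊢
    exact (eq_zero_of_inertia_le hpv hgood φ hN₁ hI (z v (Or.inl hpv)) h).2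
  -- the finite set `T` of places: `∞ ∪ {v ∣ p} ∪ Σ'`
  have hp0 : p ≠ 0 := (Fact.out : p.Prime).ne_zero
  set T : Finset (Place K) := (Finset.univ.image Sum.inl) ∪
    (((finite_setOf_natCast_mem (K := K) p hp0).toFinset ∪ hS'fin.toFinset).image Sum.inr) with hT
  have hinf : ∀ w : InfinitePlace K, (Sum.inl w : Place K) ∈ T := fun w ↦
    Finset.mem_union_left _ (Finset.mem_image_of_mem _ (Finset.mem_univ w))
  have hpT : ∀ v : HeightOneSpectrum (𝓞 K), ((p : ℕ) : 𝓞 K) ∈ v.asIdeal →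
      (Sum.inr v : Place K) ∈ T := fun v hv ↦
    Finset.mem_union_right _ (Finset.mem_image_of_mem _
      (Finset.mem_union_left _ ((Set.Finite.mem_toFinset _).mpr hv)))
  have hSig : ∀ v ∈ S', (Sum.inr v : Place K) ∈ T := fun v hv ↦
    Finset.mem_union_right _ (Finset.mem_image_of_mem _
      (Finset.mem_union_right _ ((Set.Finite.mem_toFinset _).mpr hv)))
  have hbad : ∀ v : HeightOneSpectrum (𝓞 K), ¬ W.HasGoodReductionAt v →
      (Sum.inr v : Place K) ∈ T := by
    intro v hv
    by_cases hpv : ((p : ℕ) : 𝓞 K) ∈ v.asIdeal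
    · exact hpT v hpv
    · exact hSig v ⟨hpv, Or.inl hv⟩
  have hRfin : {v : HeightOneSpectrum (𝓞 K) | (Sum.inr v : Place K) ∈ T ∧
      ((p : ℕ) : 𝓞 K) ∉ v.asIdeal}.Finite :=
    (T.finite_toSet.preimage Sum.inr_injective.injOn).subset fun v hv ↦ hv.1
  have hfinR := finite_relaxed W p (𝔮 := 𝔮) hEP hfin hRfin (fun v hv ↦ hv.2)
  -- the family of local classes on `Σ'⁺ = Σ' ∪ {𝔭}` and a common killing exponent
  have hmem : ∀ v : (insert 𝔭 S' : Set (HeightOneSpectrum (𝓞 K))),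
      ((p : ℕ) : 𝓞 K) ∉ (v : HeightOneSpectrum (𝓞 K)).asIdeal ∨
        (v : HeightOneSpectrum (𝓞 K)) = 𝔭 :=
    fun v ↦ (Set.mem_insert_iff.mp v.2).elim Or.inr fun h ↦ Or.inl h.1
  let τ : ∀ v : (insert 𝔭 S' : Set (HeightOneSpectrum (𝓞 K))),
      galoisCohomology
        ((primaryGaloisModule W p).toLocal (Sum.inr (v : HeightOneSpectrum (𝓞 K)))) 1 :=
    fun v ↦ inflDecomp hM (v : HeightOneSpectrum (𝓞 K)) (z v (hmem v))
  obtain ⟨K₀, hK₀⟩ := exists_pow_nsmul_family_eq_zero (hS'fin.insert 𝔭) τ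
  -- (4) Poitou–Tate surgery
  obtain ⟨N, xN, hxN, hloc⟩ := levelLiftingP_of_finite_noLocal W p 𝔭 S' T hPT
    (fun w ↦ IsTotallyComplex.isComplex w) hΓ h𝔭 h𝔮 hne hSp hinf hpT hSig hbad hfinR K₀ τ hK₀
  set g : galoisCohomology (primaryGaloisModule W p) 1 :=
    galoisCohomology.map (Levels.primaryInclusion W p N) 1 xN with hg
  -- (5) the corrected class
  set y : W.subgroupH1 p κ.kerSubgroup :=
    y₀ - ResKernel.resSubgroup κ.kerSubgroup (W.geomPrimaryTorsion p) (toDiscreteH1 hM g) with hy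
  have hconj : ∀ σ : absoluteGaloisGroup K, W.conjH1 p κ.kerSubgroup σ y =
      y + (W.conjH1 p κ.kerSubgroup σ y₀ - y₀) := by
    intro σ
    rw [hy, map_sub, conjH1_resSubgroup]
    abel
  -- the local computation of `y`
  have hresy : ∀ (v : HeightOneSpectrum (𝓞 K)), resKerD κ (W.geomPrimaryTorsion p) v y =
      resKerD κ (W.geomPrimaryTorsion p) v y₀ -
        ResKernel.resSubgroup (kerD κ v) (W.geomPrimaryTorsion p)
          (ResKernel.resSubgroup (decomp v) (W.geomPrimaryTorsion p) (toDiscreteH1 hM g)) := by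
    intro v
    rw [hy, map_sub, resKerD_resSubgroup]
  have haway : ∀ (v : HeightOneSpectrum (𝓞 K)), (((p : ℕ) : 𝓞 K) ∉ v.asIdeal ∨ v = 𝔭) →
      y ∈ awayKer κ.kerSubgroup (W.geomPrimaryTorsion p) v := by
    intro v hv
    rw [mem_awayKer_iff_resKerD_eq_zero, hresy]
    by_cases hvI : v ∈ insert 𝔭 S'
    · -- prescribed place: `loc_v g = infl Ψ_v`
      have hl := hloc ⟨v, hvI⟩
      have e : ResKernel.resSubgroup (decomp v) (W.geomPrimaryTorsion p) (toDiscreteH1 hM g) =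
          z v (hmem ⟨v, hvI⟩) :=
        resSubgroup_decomp_eq_of_localization_eq hM v g _ hl
      rw [e, hz, sub_self]
    · -- other place away from `p`: `loc_v g = 0` and `y₀` locally trivial
      have hpv : ((p : ℕ) : 𝓞 K) ∉ v.asIdeal := by
        rcases hv with h | rfl
        · exact h
        · exact (hvI (Set.mem_insert _ _)).elim
      have hvS : v ∉ S' := fun h ↦ hvI (Set.mem_insert_of_mem _ h)
      have h0 : galoisCohomology.localization (primaryGaloisModule W p) (Sum.inr v) 1 g = 0 :=
        localization_map_primaryInclusion_eq_zero_of_mem_upperStructureP W p N 𝔭 S' hxN h𝔭 hpv hvS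
      rw [resSubgroup_decomp_eq_zero_of_localization_eq_zero hM v g h0, map_zero, sub_zero]
      exact hzero v hpv hvS
  have hySel : y ∈ selmerAc W p κ 𝔭 ∅ := by
    change y ∈ selmerOver κ.kerSubgroup (W.geomPrimaryTorsion p) p 𝔭 ∅
    rw [mem_selmerOver_iff_awayKer]
    refine ⟨fun v hpv _ σ ↦ ?_, fun w σ ↦ ?_, fun σ ↦ ?_⟩
    · rw [hconj]
      exact add_mem (haway v (Or.inl hpv)) ((mem_awayKer_iff_resKerD_eq_zero κ v _).2
        (resKerD_eq_zero_of_mem_selmerAc (Or.inl ⟨hpv, Set.notMem_empty v⟩) (hSel σ)))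
    · exact mem_infKer_of_decompInf_eq_bot w
        (decompInf_eq_bot_of_isComplex (IsTotallyComplex.isComplex w)) _
    · rw [hconj]
      exact add_mem (haway 𝔭 (Or.inr rfl)) ((mem_awayKer_iff_resKerD_eq_zero κ 𝔭 _).2
        (resKerD_eq_zero_of_mem_selmerAc (Or.inr rfl) (hSel σ)))
  refine ⟨⟨y, hySel⟩, Subtype.ext ?_⟩
  change W.conjH1 p κ.kerSubgroup γ y - y = (x : W.subgroupH1 p κ.kerSubgroup)
  rw [hconj, hy₀]
  abel

end Coinvariants

end Summit.BirchSwinnertonDyer.BirchSwinnertonDyer.Theorems.SchneiderFreeAdditiveX3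

end
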